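import Mathlib
import HarnessLib
import Literature.MathematicalPhysics.StatisticalMechanics.RenormalisationMapTwoKernelRaw
import Literature.MathematicalPhysics.StatisticalMechanics.RenormalisationMapDecompositionFreeHt
import Literature.MathematicalPhysics.StatisticalMechanics.RenormalisationMapBlockDefect

/-!
# `K_{k+1}` for TWO STEP KERNELS at a COMMON FREE intermediate Hamiltonian `H̃`: glue and RAW per-polymer bound
# ([ABKM19] Theorem 6.8 (6.59)–(6.60) ⊗ Lemma 8.4 ⊗ Lemma 9.3; hypothesis (12.53) of Lemma 12.6, kernel pair at free `H̃`)

With the free-`H̃` decomposition (`RenormalisationMapDecompositionFreeHt`) for two step data `D, D_b` (same `s, L`, reference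
block; kernels `𝒞_a, 𝒞_b`) at the SAME free `H̃` and state `(H, K)`:
`nextK(μ_a; e^{−H}, e^{−H̃}, K)(U) − nextK(μ_b; e^{−H}, e^{−H̃}, K)(U) = [blockPart_a − blockPart_b] + Σᵢ [Σᵢ(D; H̃) − Σᵢ(D_b; H̃)]
  + Σ_B p_B(H̃)(e^{−H̃_a(B)} − e^{−H̃_b(B)})`, `H̃_a = nextH D H K`, `H̃_b = nextH D_b H K`.
The five kernel brackets are EXACTLY the landed kernel-only twins (`LinearisedMapBlockPartKernelOnly`,
`RenormalisationMapRemainderOneKernelOnly`, `…RemainderTwoLargeKernelOnly`, `…RemaindersThreeFourKernelOnly`), which are stated with a free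
prefactor Hamiltonian; the last term is the defect twin (`RenormalisationMapBlockDefect` with `H₁ = H̃_a`, `H₂ = H̃_b`, size
`16e^{3/8}‖H̃_a − H̃_b‖_{k,0}`, itself `O(|q_a − q_b|₁)` by `NextHamiltonianKernelSubABKM`).  In contrast to the tied two-kernel bound
(`RenormalisationMapTwoKernelRaw`) NO one-kernel `H̃`-variation brackets occur.

* `tayNormLE_nextK_freeHt_kernel_sub_of_pieces` — the GLUE (six piece bounds with arbitrary constants `c₀,…,c₅`);
* `tayNormLE_nextK_freeHt_kernel_sub_abkm_raw_of_stepKernelBounds` — the RAW bound with the explicit constants of the pieces (pair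
  properties of Lemma 8.4 as hypotheses: `(ℓc, κc)` on connected `k`-polymers, `(ℓn, κ_p)` near `U`; letters `τ, ω, κ, κ₁`).

This is the per-polymer form of the free-`H̃` KERNEL PAIR bound (U2) of the blocks B2/B3 of the stub `stub_f4l2ShrinkLoc` (second-order
two-kernel slot (F4l2), [ABKM19] Lemma 12.6 (12.53) at `ℓ = 2`): uniformly for `H̃` on a ball, `H̃ ↦ nextK(μ_a; H̃) − nextK(μ_b; H̃)` is
`O(|q_a − q_b|₁)`; the weak-norm conversion with room and the package discharge follow the stub-1 templates
(`RenormalisationMapTwoKernelWeak`, `…TwoKernelNextKStepLoc`).  Everything is proved; no named fact.  Honest scope: rung route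
`Summits/HubbardSuperconductivity/…/Theses/ComplexGFFStiffness` (stiffness of a complex Gaussian gradient field via the [ABKM19] RG);
nothing about superconductivity in the Hubbard model is claimed or advanced.

## References
* S. Adams, S. Buchholz, R. Kotecký, S. Müller, arXiv:1910.13564, Theorem 6.8 ((6.59)–(6.60)), Lemma 8.4, Lemma 9.3, Lemma 9.6,
  Ch. 10.1, Lemma 12.6 (12.53) [AdamsBuchholzKoteckyMuller2019].
-/

noncomputable section

namespace Literature.MathematicalPhysics.StatisticalMechanics.GradientRG

open scoped BigOperators Classical
open Finset MeasureTheory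
open Literature.MathematicalPhysics.StatisticalMechanics.TorusPolymer
  (IsPolymer blocks polys bprod blockOf thicken reblock boxCorner mem_polys mem_blocks numBlocks isPolymer_blockOf
    card_blocks_eq_numBlocks blocks_blockOf empty_mem_polys closure mem_blockOf_self)
open Literature.Barriers.CriticalPhenomena.LongRangePhi4.Polymer (IsConn components)
open Literature.MathematicalPhysics.StatisticalMechanics.GradientFRD (iterDiff)
open Literature.MathematicalPhysics.QuantumFieldTheory

variable {d M : ℕ} [NeZero M]

set_option maxHeartbeats 1600000 in
/-- **Glue (two kernels, common free `H̃`).** Six piece bounds — the block part, the kernel-only twins of `Σ₁, Σ₂ᴸ, Σ₃, Σ₄` at the common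
prefactor Hamiltonian `H̃`, and the defect twin — with constants `c₀,…,c₅` give
`‖nextK(μ_a; e^{−H}, e^{−H̃}, K)(U) − nextK(μ_b; e^{−H}, e^{−H̃}, K)(U)‖ ≤ c₀+⋯+c₅` (torus data, `D.s = D_b.s = L^k`, `D.L = D_b.L = L`,
`‖H‖_{k,0} ≤ 1/8`, admissible `K` with `K(∅) = 1`, `U ≠ ∅`). [cite: AdamsBuchholzKoteckyMuller2019, Theorem 6.8 / Ch. 9.1 / Ch. 10.1] -/
theorem tayNormLE_nextK_freeHt_kernel_sub_of_pieces {L N Mord R n p r₀ : ℕ}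
    {θbar lam μ δ₁ δ₀ A𝒫 A𝒫a A𝒫b C₂a C₂b h A : ℝ}
    {𝒞 : ℕ → (Fin d → ZMod M) → ℝ} (hd : 2 ≤ d) (hLodd : Odd L) (hL : 2 ^ (d + 3) + 16 * R ≤ L)
    (hM : M = L ^ N) {k : ℕ} (hkN : k + 1 ≤ N) (hp : d / 2 + 1 ≤ p) (hpR : p ≤ R) (hMord : d / 2 + 1 ≤ Mord)
    (hB : AbkmWeightBounds L N Mord R n θbar lam μ δ₁ δ₀ A𝒫 𝒞
      (abkmWeightData L N Mord R θbar (schedDelta δ₀ δ₁ N) 𝒞))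
    (hδ₀ : 0 < δ₀) (hδ₁ : 0 < δ₁) (hh : 0 < h) (hh0 : hZeroSq d R δ₀ δ₁ ≤ h ^ 2) (hA : 0 < A)
    (D Db : StepData d M) (hDs : D.s = L ^ k) (hDL : D.L = L) (hDbs : Db.s = L ^ k) (hDbL : Db.L = L)
    (hS : StepKernelBounds (abkmWeightData L N Mord R θbar (schedDelta δ₀ δ₁ N) 𝒞) L k A𝒫a C₂a D.𝒞)
    (hSb : StepKernelBounds (abkmWeightData L N Mord R θbar (schedDelta δ₀ δ₁ N) 𝒞) L k A𝒫b C₂b Db.𝒞)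
    {x₀ x₀' : Fin d → ZMod M} (hB₀ : D.B₀ = blockOf (L ^ k) x₀) (hc₀ : D.c₀ = boxCorner (L ^ k) (starRad R L d k) x₀)
    (hB₀b : Db.B₀ = blockOf (L ^ k) x₀') (hc₀b : Db.c₀ = boxCorner (L ^ k) (starRad R L d k) x₀')
    {H : RelevantHamiltonian ℂ d}
    (hH : hamNorm (fieldWt h (L : ℝ) d k) ((L : ℝ) ^ k) (L ^ (d * k)) H ≤ 1 / 8)
    (Ht : RelevantHamiltonian ℂ d)
    {K : Finset (Fin d → ZMod M) → ((Fin d → ZMod M) → ℝ) → ℂ} {C : ℝ} (hC : 0 ≤ C)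
    (hK : WeakNormLE (abkmNormParams L N Mord R p r₀ h θbar A (schedDelta δ₀ δ₁ N) 𝒞) k K C)
    (hKfac : Factorises (L ^ k) K) (hK0 : ∀ φ, K ∅ φ = 1) (hKd : ∀ Y, ContDiff ℝ r₀ (K Y))
    (hKloc : ∀ Y, IsPolymer (L ^ k) Y → IsConn Y →
      IsGaugeLocal ((abkmNormParams L N Mord R p r₀ h θbar A (schedDelta δ₀ δ₁ N) 𝒞).gauge k Y) (K Y))
    {U : Finset (Fin d → ZMod M)} (hUne : U.Nonempty)
    {c₀ c₁ c₂ c₃ c₄ c₅ : ℝ}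
    (h0 : TayNormLE ((abkmNormParams L N Mord R p r₀ h θbar A (schedDelta δ₀ δ₁ N) 𝒞).gauge (k + 1) U) r₀
      ((abkmWeightData L N Mord R θbar (schedDelta δ₀ δ₁ N) 𝒞).weight (k + 1) U)
      (fun φ => blockPart D K U φ - blockPart Db K U φ) c₀)
    (h1 : TayNormLE ((abkmNormParams L N Mord R p r₀ h θbar A (schedDelta δ₀ δ₁ N) 𝒞).gauge (k + 1) U) r₀
      ((abkmWeightData L N Mord R θbar (schedDelta δ₀ δ₁ N) 𝒞).weight (k + 1) U)
      (fun φ => (∑ B ∈ blockPartIndex D U,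
        ((bprod (L ^ k) (fun B' => expNegH (Ht) B' φ) (U \ B) *
              bprod (L ^ k) (fun B' => expNegH (-(Ht)) B' φ) (B \ U) - 1) * blockTerm D K B φ +
          bprod (L ^ k) (fun B' => expNegH (Ht) B' φ) (U \ B) *
              bprod (L ^ k) (fun B' => expNegH (-(Ht)) B' φ) (B \ U) *
            (fluctDefect D.𝒞 H B φ +
              (expNegH (stepOpA (gradCov D.𝒞) H) B φ - 1) * (1 - Complex.exp (-(eval (opB D K) B φ))) -
              (Complex.exp (-(eval (opB D K) B φ)) - 1 + eval (opB D K) B φ)) +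
          bprod (L ^ k) (fun B' => expNegH (Ht) B' φ) (U \ B) *
              bprod (L ^ k) (fun B' => expNegH (-(Ht)) B' φ) (B \ U) *
            fluct D.𝒞 (fun ψ => ∑ Y ∈ ((polys (L ^ k) B).erase B).erase ∅,
              bprod (L ^ k) (fun B' => expNegH H B' ψ - 1) (B \ Y) * K Y ψ) φ)) -
        (∑ B ∈ blockPartIndex D U,
        ((bprod (L ^ k) (fun B' => expNegH (Ht) B' φ) (U \ B) *
              bprod (L ^ k) (fun B' => expNegH (-(Ht)) B' φ) (B \ U) - 1) * blockTerm Db K B φ +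
          bprod (L ^ k) (fun B' => expNegH (Ht) B' φ) (U \ B) *
              bprod (L ^ k) (fun B' => expNegH (-(Ht)) B' φ) (B \ U) *
            (fluctDefect Db.𝒞 H B φ +
              (expNegH (stepOpA (gradCov Db.𝒞) H) B φ - 1) * (1 - Complex.exp (-(eval (opB Db K) B φ))) -
              (Complex.exp (-(eval (opB Db K) B φ)) - 1 + eval (opB Db K) B φ)) +
          bprod (L ^ k) (fun B' => expNegH (Ht) B' φ) (U \ B) *
              bprod (L ^ k) (fun B' => expNegH (-(Ht)) B' φ) (B \ U) *
            fluct Db.𝒞 (fun ψ => ∑ Y ∈ ((polys (L ^ k) B).erase B).erase ∅,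
              bprod (L ^ k) (fun B' => expNegH H B' ψ - 1) (B \ Y) * K Y ψ) φ))) c₁)
    (h2 : TayNormLE ((abkmNormParams L N Mord R p r₀ h θbar A (schedDelta δ₀ δ₁ N) 𝒞).gauge (k + 1) U) r₀
      ((abkmWeightData L N Mord R θbar (schedDelta δ₀ δ₁ N) 𝒞).weight (k + 1) U)
      (fun φ => ∑ X ∈ largePartIndex (L ^ k) L U,
        ((bprod (L ^ k) (fun B => expNegH (Ht) B φ) (U \ X) * bprod (L ^ k) (fun B => expNegH (-(Ht)) B φ) (X \ U) *
            (fluct D.𝒞 (polyP2 (L ^ k) H K X) φ + bprod (L ^ k) (fun B => 1 - expNegH (Ht) B φ) X)) -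
          (bprod (L ^ k) (fun B => expNegH (Ht) B φ) (U \ X) * bprod (L ^ k) (fun B => expNegH (-(Ht)) B φ) (X \ U) *
            (fluct Db.𝒞 (polyP2 (L ^ k) H K X) φ + bprod (L ^ k) (fun B => 1 - expNegH (Ht) B φ) X)))) c₂)
    (h3 : TayNormLE ((abkmNormParams L N Mord R p r₀ h θbar A (schedDelta δ₀ δ₁ N) 𝒞).gauge (k + 1) U) r₀
      ((abkmWeightData L N Mord R θbar (schedDelta δ₀ δ₁ N) 𝒞).weight (k + 1) U)
      (fun φ => ∑ X ∈ ((polys (L ^ k) univ).filter (fun X => reblock (L ^ k) (L * L ^ k) X = U)).filter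
          (fun X => ¬ IsConn X),
        ((bprod (L ^ k) (fun B => expNegH (Ht) B φ) (U \ X) * bprod (L ^ k) (fun B => expNegH (-(Ht)) B φ) (X \ U) *
            (fluct D.𝒞 (polyP2 (L ^ k) H K X) φ + bprod (L ^ k) (fun B => 1 - expNegH (Ht) B φ) X)) -
          (bprod (L ^ k) (fun B => expNegH (Ht) B φ) (U \ X) * bprod (L ^ k) (fun B => expNegH (-(Ht)) B φ) (X \ U) *
            (fluct Db.𝒞 (polyP2 (L ^ k) H K X) φ + bprod (L ^ k) (fun B => 1 - expNegH (Ht) B φ) X)))) c₃)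
    (h4 : TayNormLE ((abkmNormParams L N Mord R p r₀ h θbar A (schedDelta δ₀ δ₁ N) 𝒞).gauge (k + 1) U) r₀
      ((abkmWeightData L N Mord R θbar (schedDelta δ₀ δ₁ N) 𝒞).weight (k + 1) U)
      (fun φ => ∑ X ∈ (polys (L ^ k) univ).filter (fun X => reblock (L ^ k) (L * L ^ k) X = U),
        ∑ X₁ ∈ ((polys (L ^ k) X).erase X).erase ∅,
        ((bprod (L ^ k) (fun B => expNegH (Ht) B φ) (U \ X) * bprod (L ^ k) (fun B => expNegH (-(Ht)) B φ) (X \ U) *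
            (bprod (L ^ k) (fun B => 1 - expNegH (Ht) B φ) X₁ * fluct D.𝒞 (polyP2 (L ^ k) H K (X \ X₁)) φ)) -
          (bprod (L ^ k) (fun B => expNegH (Ht) B φ) (U \ X) * bprod (L ^ k) (fun B => expNegH (-(Ht)) B φ) (X \ U) *
            (bprod (L ^ k) (fun B => 1 - expNegH (Ht) B φ) X₁ * fluct Db.𝒞 (polyP2 (L ^ k) H K (X \ X₁)) φ)))) c₄)
    (h5 : TayNormLE ((abkmNormParams L N Mord R p r₀ h θbar A (schedDelta δ₀ δ₁ N) 𝒞).gauge (k + 1) U) r₀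
      ((abkmWeightData L N Mord R θbar (schedDelta δ₀ δ₁ N) 𝒞).weight (k + 1) U)
      (fun φ => (∑ B ∈ blockPartIndex D U,
        bprod (L ^ k) (fun B' => expNegH Ht B' φ) (U \ B) *
            bprod (L ^ k) (fun B' => expNegH (-Ht) B' φ) (B \ U) *
          (expNegH (nextH D H K) B φ - expNegH Ht B φ)) -
        (∑ B ∈ blockPartIndex D U,
        bprod (L ^ k) (fun B' => expNegH Ht B' φ) (U \ B) *
            bprod (L ^ k) (fun B' => expNegH (-Ht) B' φ) (B \ U) *
          (expNegH (nextH Db H K) B φ - expNegH Ht B φ))) c₅) :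
    TayNormLE ((abkmNormParams L N Mord R p r₀ h θbar A (schedDelta δ₀ δ₁ N) 𝒞).gauge (k + 1) U) r₀
      ((abkmWeightData L N Mord R θbar (schedDelta δ₀ δ₁ N) 𝒞).weight (k + 1) U)
      (fun φ => nextK D.s (reblock D.s (D.L * D.s)) (stepMeasure D.𝒞) (expNegH H) (expNegH Ht) K U φ -
        nextK Db.s (reblock Db.s (Db.L * Db.s)) (stepMeasure Db.𝒞) (expNegH H) (expNegH Ht) K U φ)
      (c₀ + c₁ + c₂ + c₃ + c₄ + c₅) := by
  have hk1 : k + 1 ≤ N + 1 := by omega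
  have hMo : Odd M := by rw [hM]; exact hLodd.pow
  have hsodd : Odd (L ^ k) := hLodd.pow
  -- smoothness of the single-data functionals
  have hUk : ∀ X ∈ ((polys (L ^ k) univ).filter (fun X => reblock (L ^ k) (L * L ^ k) X = U)), IsPolymer (L ^ k) X :=
    fun X hX => (mem_polys.1 (mem_filter.1 hX).1).2
  have hF0d : ContDiff ℝ r₀ (fun φ => blockPart D K U φ - blockPart Db K U φ) :=
    (contDiff_blockPart_abkm_of_stepKernelBounds hB hLodd hM hA D hDs hS hC hK hKd hKloc U).sub
      (contDiff_blockPart_abkm_of_stepKernelBounds hB hLodd hM hA Db hDbs hSb hC hK hKd hKloc U)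
  have hblk : ∀ B ∈ blockPartIndex D U, ∃ y, B = blockOf (L ^ k) y := fun B hB' => by
    have hBb := blockPartIndex_subset_blocks D U hB'
    rw [hDs] at hBb
    obtain ⟨y, -, rfl⟩ := mem_blocks.1 hBb
    exact ⟨y, rfl⟩
  have hS1d : ∀ (Dq : StepData d M) {A𝒫q C₂q : ℝ},
      StepKernelBounds (abkmWeightData L N Mord R θbar (schedDelta δ₀ δ₁ N) 𝒞) L k A𝒫q C₂q Dq.𝒞 →
      ∀ (Ht : RelevantHamiltonian ℂ d), ContDiff ℝ r₀ (fun φ : (Fin d → ZMod M) → ℝ => (∑ B ∈ blockPartIndex D U,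
        ((bprod (L ^ k) (fun B' => expNegH (Ht) B' φ) (U \ B) *
              bprod (L ^ k) (fun B' => expNegH (-(Ht)) B' φ) (B \ U) - 1) * blockTerm Dq K B φ +
          bprod (L ^ k) (fun B' => expNegH (Ht) B' φ) (U \ B) *
              bprod (L ^ k) (fun B' => expNegH (-(Ht)) B' φ) (B \ U) *
            (fluctDefect Dq.𝒞 H B φ +
              (expNegH (stepOpA (gradCov Dq.𝒞) H) B φ - 1) * (1 - Complex.exp (-(eval (opB Dq K) B φ))) -
              (Complex.exp (-(eval (opB Dq K) B φ)) - 1 + eval (opB Dq K) B φ)) +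
          bprod (L ^ k) (fun B' => expNegH (Ht) B' φ) (U \ B) *
              bprod (L ^ k) (fun B' => expNegH (-(Ht)) B' φ) (B \ U) *
            fluct Dq.𝒞 (fun ψ => ∑ Y ∈ ((polys (L ^ k) B).erase B).erase ∅,
              bprod (L ^ k) (fun B' => expNegH H B' ψ - 1) (B \ Y) * K Y ψ) φ))) := by
    intro Dq A𝒫q C₂q hSq Ht
    refine ContDiff.sum fun B hB' => ?_
    obtain ⟨y, rfl⟩ := hblk B hB'
    exact contDiff_blockSummand_abkm_of_stepKernelBounds (p := p) (r₀ := r₀) (A := A) hd hB hLodd hM hkN hδ₀ hδ₁ hh hh0 hMord hp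
      hA Dq hSq y Ht hH hC hK hKd hKloc U
  have hT2d : ∀ (𝒞q : (Fin d → ZMod M) → ℝ) {A𝒫q C₂q : ℝ},
      StepKernelBounds (abkmWeightData L N Mord R θbar (schedDelta δ₀ δ₁ N) 𝒞) L k A𝒫q C₂q 𝒞q →
      ∀ (Ht : RelevantHamiltonian ℂ d) (X : Finset (Fin d → ZMod M)), IsPolymer (L ^ k) X →
      ContDiff ℝ r₀ (fun φ : (Fin d → ZMod M) → ℝ =>
        bprod (L ^ k) (fun B => expNegH (Ht) B φ) (U \ X) * bprod (L ^ k) (fun B => expNegH (-(Ht)) B φ) (X \ U) *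
            (fluct 𝒞q (polyP2 (L ^ k) H K X) φ + bprod (L ^ k) (fun B => 1 - expNegH (Ht) B φ) X)) :=
    fun 𝒞q A𝒫q C₂q hSq Ht X hXp =>
      contDiff_reblockTop_abkm_of_stepKernelBounds hd hLodd hM hkN hSq hp hMord hB hδ₀ hδ₁ hh hh0 hA hXp Ht hH hC
        hK hKfac hK0 hKd hKloc U
  have hT4d : ∀ (𝒞q : (Fin d → ZMod M) → ℝ) {A𝒫q C₂q : ℝ},
      StepKernelBounds (abkmWeightData L N Mord R θbar (schedDelta δ₀ δ₁ N) 𝒞) L k A𝒫q C₂q 𝒞q →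
      ∀ (Ht : RelevantHamiltonian ℂ d) (X : Finset (Fin d → ZMod M)), IsPolymer (L ^ k) X →
      ∀ X₁ ∈ polys (L ^ k) X,
      ContDiff ℝ r₀ (fun φ : (Fin d → ZMod M) → ℝ =>
        bprod (L ^ k) (fun B => expNegH (Ht) B φ) (U \ X) * bprod (L ^ k) (fun B => expNegH (-(Ht)) B φ) (X \ U) *
            (bprod (L ^ k) (fun B => 1 - expNegH (Ht) B φ) X₁ * fluct 𝒞q (polyP2 (L ^ k) H K (X \ X₁)) φ)) :=
    fun 𝒞q A𝒫q C₂q hSq Ht X hXp X₁ hX₁ =>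
      contDiff_reblockSub_abkm_of_stepKernelBounds hd hLodd hM hkN hSq hp hMord hB hδ₀ hδ₁ hh hh0 hA hXp hX₁ Ht hH
        hC hK hKfac hK0 hKd hKloc U
  have hcdE : ∀ (H₀ : RelevantHamiltonian ℂ d) (Z : Finset (Fin d → ZMod M)),
      ContDiff ℝ r₀ (fun φ : (Fin d → ZMod M) → ℝ => bprod (L ^ k) (fun B => expNegH H₀ B φ) Z) := by
    intro H₀ Z
    unfold TorusPolymer.bprod
    exact contDiff_prod fun B _ => (contDiff_eval H₀ B (n := r₀)).neg.cexp
  have hexpd : ∀ (H₀ : RelevantHamiltonian ℂ d) (B : Finset (Fin d → ZMod M)), ContDiff ℝ r₀ (expNegH H₀ B) := by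
    intro H₀ B
    show ContDiff ℝ r₀ (fun φ : (Fin d → ZMod M) → ℝ => Complex.exp (-(eval H₀ B φ)))
    exact (contDiff_eval H₀ B (n := r₀)).neg.cexp
  have hF1d : ContDiff ℝ r₀ (fun φ => (∑ B ∈ blockPartIndex D U,
        ((bprod (L ^ k) (fun B' => expNegH (Ht) B' φ) (U \ B) *
              bprod (L ^ k) (fun B' => expNegH (-(Ht)) B' φ) (B \ U) - 1) * blockTerm D K B φ +
          bprod (L ^ k) (fun B' => expNegH (Ht) B' φ) (U \ B) *
              bprod (L ^ k) (fun B' => expNegH (-(Ht)) B' φ) (B \ U) *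
            (fluctDefect D.𝒞 H B φ +
              (expNegH (stepOpA (gradCov D.𝒞) H) B φ - 1) * (1 - Complex.exp (-(eval (opB D K) B φ))) -
              (Complex.exp (-(eval (opB D K) B φ)) - 1 + eval (opB D K) B φ)) +
          bprod (L ^ k) (fun B' => expNegH (Ht) B' φ) (U \ B) *
              bprod (L ^ k) (fun B' => expNegH (-(Ht)) B' φ) (B \ U) *
            fluct D.𝒞 (fun ψ => ∑ Y ∈ ((polys (L ^ k) B).erase B).erase ∅,
              bprod (L ^ k) (fun B' => expNegH H B' ψ - 1) (B \ Y) * K Y ψ) φ)) -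
        (∑ B ∈ blockPartIndex D U,
        ((bprod (L ^ k) (fun B' => expNegH (Ht) B' φ) (U \ B) *
              bprod (L ^ k) (fun B' => expNegH (-(Ht)) B' φ) (B \ U) - 1) * blockTerm Db K B φ +
          bprod (L ^ k) (fun B' => expNegH (Ht) B' φ) (U \ B) *
              bprod (L ^ k) (fun B' => expNegH (-(Ht)) B' φ) (B \ U) *
            (fluctDefect Db.𝒞 H B φ +
              (expNegH (stepOpA (gradCov Db.𝒞) H) B φ - 1) * (1 - Complex.exp (-(eval (opB Db K) B φ))) -
              (Complex.exp (-(eval (opB Db K) B φ)) - 1 + eval (opB Db K) B φ)) +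
          bprod (L ^ k) (fun B' => expNegH (Ht) B' φ) (U \ B) *
              bprod (L ^ k) (fun B' => expNegH (-(Ht)) B' φ) (B \ U) *
            fluct Db.𝒞 (fun ψ => ∑ Y ∈ ((polys (L ^ k) B).erase B).erase ∅,
              bprod (L ^ k) (fun B' => expNegH H B' ψ - 1) (B \ Y) * K Y ψ) φ))) := (hS1d D hS Ht).sub (hS1d Db hSb Ht)
  have hF2d : ContDiff ℝ r₀ (fun φ => ∑ X ∈ largePartIndex (L ^ k) L U,
        ((bprod (L ^ k) (fun B => expNegH (Ht) B φ) (U \ X) * bprod (L ^ k) (fun B => expNegH (-(Ht)) B φ) (X \ U) *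
            (fluct D.𝒞 (polyP2 (L ^ k) H K X) φ + bprod (L ^ k) (fun B => 1 - expNegH (Ht) B φ) X)) -
          (bprod (L ^ k) (fun B => expNegH (Ht) B φ) (U \ X) * bprod (L ^ k) (fun B => expNegH (-(Ht)) B φ) (X \ U) *
            (fluct Db.𝒞 (polyP2 (L ^ k) H K X) φ + bprod (L ^ k) (fun B => 1 - expNegH (Ht) B φ) X)))) := by
    refine ContDiff.sum fun X hX => ?_
    obtain ⟨hXp, -, -, -⟩ := mem_largePartIndex.1 hX
    exact (hT2d D.𝒞 hS Ht X hXp).sub (hT2d Db.𝒞 hSb Ht X hXp)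
  have hF3d : ContDiff ℝ r₀ (fun φ => ∑ X ∈ ((polys (L ^ k) univ).filter (fun X => reblock (L ^ k) (L * L ^ k) X = U)).filter
          (fun X => ¬ IsConn X),
        ((bprod (L ^ k) (fun B => expNegH (Ht) B φ) (U \ X) * bprod (L ^ k) (fun B => expNegH (-(Ht)) B φ) (X \ U) *
            (fluct D.𝒞 (polyP2 (L ^ k) H K X) φ + bprod (L ^ k) (fun B => 1 - expNegH (Ht) B φ) X)) -
          (bprod (L ^ k) (fun B => expNegH (Ht) B φ) (U \ X) * bprod (L ^ k) (fun B => expNegH (-(Ht)) B φ) (X \ U) *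
            (fluct Db.𝒞 (polyP2 (L ^ k) H K X) φ + bprod (L ^ k) (fun B => 1 - expNegH (Ht) B φ) X)))) := by
    refine ContDiff.sum fun X hX => ?_
    have hXp := hUk X (mem_filter.1 hX).1
    exact (hT2d D.𝒞 hS Ht X hXp).sub (hT2d Db.𝒞 hSb Ht X hXp)
  have hF4d : ContDiff ℝ r₀ (fun φ => ∑ X ∈ (polys (L ^ k) univ).filter (fun X => reblock (L ^ k) (L * L ^ k) X = U),
        ∑ X₁ ∈ ((polys (L ^ k) X).erase X).erase ∅,
        ((bprod (L ^ k) (fun B => expNegH (Ht) B φ) (U \ X) * bprod (L ^ k) (fun B => expNegH (-(Ht)) B φ) (X \ U) *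
            (bprod (L ^ k) (fun B => 1 - expNegH (Ht) B φ) X₁ * fluct D.𝒞 (polyP2 (L ^ k) H K (X \ X₁)) φ)) -
          (bprod (L ^ k) (fun B => expNegH (Ht) B φ) (U \ X) * bprod (L ^ k) (fun B => expNegH (-(Ht)) B φ) (X \ U) *
            (bprod (L ^ k) (fun B => 1 - expNegH (Ht) B φ) X₁ * fluct Db.𝒞 (polyP2 (L ^ k) H K (X \ X₁)) φ)))) := by
    refine ContDiff.sum fun X hX => ContDiff.sum fun X₁ hX₁ => ?_
    have hXp := hUk X hX
    have hX₁p : X₁ ∈ polys (L ^ k) X := mem_of_mem_erase (mem_of_mem_erase hX₁)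
    exact (hT4d D.𝒞 hS Ht X hXp X₁ hX₁p).sub (hT4d Db.𝒞 hSb Ht X hXp X₁ hX₁p)
  have hF5d : ContDiff ℝ r₀ (fun φ => (∑ B ∈ blockPartIndex D U,
        bprod (L ^ k) (fun B' => expNegH Ht B' φ) (U \ B) *
            bprod (L ^ k) (fun B' => expNegH (-Ht) B' φ) (B \ U) *
          (expNegH (nextH D H K) B φ - expNegH Ht B φ)) -
        (∑ B ∈ blockPartIndex D U,
        bprod (L ^ k) (fun B' => expNegH Ht B' φ) (U \ B) *
            bprod (L ^ k) (fun B' => expNegH (-Ht) B' φ) (B \ U) *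
          (expNegH (nextH Db H K) B φ - expNegH Ht B φ))) := by
    refine (ContDiff.sum fun B _ => ?_).sub (ContDiff.sum fun B _ => ?_)
    · exact ((hcdE Ht (U \ B)).mul (hcdE (-Ht) (B \ U))).mul ((hexpd (nextH D H K) B).sub (hexpd Ht B))
    · exact ((hcdE Ht (U \ B)).mul (hcdE (-Ht) (B \ U))).mul ((hexpd (nextH Db H K) B).sub (hexpd Ht B))
  -- the sum of the six bounds
  have s1 := h0.add h1 hF0d hF1d
  have s2 := s1.add h2 (hF0d.add hF1d) hF2d
  have s3 := s2.add h3 ((hF0d.add hF1d).add hF2d) hF3d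
  have s4 := s3.add h4 (((hF0d.add hF1d).add hF2d).add hF3d) hF4d
  have s5 := s4.add h5 ((((hF0d.add hF1d).add hF2d).add hF3d).add hF4d) hF5d
  -- the free-`H̃` decompositions of the two data at the same `H̃`
  have hdecF := nextK_freeHt_eq_blockPart_add_remainders_abkm_of_stepKernelBounds (p := p) (r₀ := r₀) (A := A) hd hLodd hL hM hkN
    hp hpR hMord hB hδ₀ hδ₁ hh hh0 hA D hDs hDL hS hB₀ hc₀ hH Ht hC hK hKfac hK0 hKd hKloc hUne
  have hdecF' := nextK_freeHt_eq_blockPart_add_remainders_abkm_of_stepKernelBounds (p := p) (r₀ := r₀) (A := A) hd hLodd hL hM hkN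
    hp hpR hMord hB hδ₀ hδ₁ hh hh0 hA Db hDbs hDbL hSb hB₀b hc₀b hH Ht hC hK hKfac hK0 hKd hKloc hUne
  have hbpi : blockPartIndex Db U = blockPartIndex D U := by
    unfold blockPartIndex; rw [hDbs, hDbL, hDs, hDL]
  have hfun : (fun φ => nextK D.s (reblock D.s (D.L * D.s)) (stepMeasure D.𝒞) (expNegH H) (expNegH Ht) K U φ -
        nextK Db.s (reblock Db.s (Db.L * Db.s)) (stepMeasure Db.𝒞) (expNegH H) (expNegH Ht) K U φ) =
      (fun φ => blockPart D K U φ - blockPart Db K U φ) + (fun φ => (∑ B ∈ blockPartIndex D U,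
        ((bprod (L ^ k) (fun B' => expNegH (Ht) B' φ) (U \ B) *
              bprod (L ^ k) (fun B' => expNegH (-(Ht)) B' φ) (B \ U) - 1) * blockTerm D K B φ +
          bprod (L ^ k) (fun B' => expNegH (Ht) B' φ) (U \ B) *
              bprod (L ^ k) (fun B' => expNegH (-(Ht)) B' φ) (B \ U) *
            (fluctDefect D.𝒞 H B φ +
              (expNegH (stepOpA (gradCov D.𝒞) H) B φ - 1) * (1 - Complex.exp (-(eval (opB D K) B φ))) -
              (Complex.exp (-(eval (opB D K) B φ)) - 1 + eval (opB D K) B φ)) +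
          bprod (L ^ k) (fun B' => expNegH (Ht) B' φ) (U \ B) *
              bprod (L ^ k) (fun B' => expNegH (-(Ht)) B' φ) (B \ U) *
            fluct D.𝒞 (fun ψ => ∑ Y ∈ ((polys (L ^ k) B).erase B).erase ∅,
              bprod (L ^ k) (fun B' => expNegH H B' ψ - 1) (B \ Y) * K Y ψ) φ)) -
        (∑ B ∈ blockPartIndex D U,
        ((bprod (L ^ k) (fun B' => expNegH (Ht) B' φ) (U \ B) *
              bprod (L ^ k) (fun B' => expNegH (-(Ht)) B' φ) (B \ U) - 1) * blockTerm Db K B φ +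
          bprod (L ^ k) (fun B' => expNegH (Ht) B' φ) (U \ B) *
              bprod (L ^ k) (fun B' => expNegH (-(Ht)) B' φ) (B \ U) *
            (fluctDefect Db.𝒞 H B φ +
              (expNegH (stepOpA (gradCov Db.𝒞) H) B φ - 1) * (1 - Complex.exp (-(eval (opB Db K) B φ))) -
              (Complex.exp (-(eval (opB Db K) B φ)) - 1 + eval (opB Db K) B φ)) +
          bprod (L ^ k) (fun B' => expNegH (Ht) B' φ) (U \ B) *
              bprod (L ^ k) (fun B' => expNegH (-(Ht)) B' φ) (B \ U) *
            fluct Db.𝒞 (fun ψ => ∑ Y ∈ ((polys (L ^ k) B).erase B).erase ∅,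
              bprod (L ^ k) (fun B' => expNegH H B' ψ - 1) (B \ Y) * K Y ψ) φ))) + (fun φ => ∑ X ∈ largePartIndex (L ^ k) L U,
        ((bprod (L ^ k) (fun B => expNegH (Ht) B φ) (U \ X) * bprod (L ^ k) (fun B => expNegH (-(Ht)) B φ) (X \ U) *
            (fluct D.𝒞 (polyP2 (L ^ k) H K X) φ + bprod (L ^ k) (fun B => 1 - expNegH (Ht) B φ) X)) -
          (bprod (L ^ k) (fun B => expNegH (Ht) B φ) (U \ X) * bprod (L ^ k) (fun B => expNegH (-(Ht)) B φ) (X \ U) *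
            (fluct Db.𝒞 (polyP2 (L ^ k) H K X) φ + bprod (L ^ k) (fun B => 1 - expNegH (Ht) B φ) X)))) + (fun φ => ∑ X ∈ ((polys (L ^ k) univ).filter (fun X => reblock (L ^ k) (L * L ^ k) X = U)).filter
          (fun X => ¬ IsConn X),
        ((bprod (L ^ k) (fun B => expNegH (Ht) B φ) (U \ X) * bprod (L ^ k) (fun B => expNegH (-(Ht)) B φ) (X \ U) *
            (fluct D.𝒞 (polyP2 (L ^ k) H K X) φ + bprod (L ^ k) (fun B => 1 - expNegH (Ht) B φ) X)) -
          (bprod (L ^ k) (fun B => expNegH (Ht) B φ) (U \ X) * bprod (L ^ k) (fun B => expNegH (-(Ht)) B φ) (X \ U) *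
            (fluct Db.𝒞 (polyP2 (L ^ k) H K X) φ + bprod (L ^ k) (fun B => 1 - expNegH (Ht) B φ) X)))) + (fun φ => ∑ X ∈ (polys (L ^ k) univ).filter (fun X => reblock (L ^ k) (L * L ^ k) X = U),
        ∑ X₁ ∈ ((polys (L ^ k) X).erase X).erase ∅,
        ((bprod (L ^ k) (fun B => expNegH (Ht) B φ) (U \ X) * bprod (L ^ k) (fun B => expNegH (-(Ht)) B φ) (X \ U) *
            (bprod (L ^ k) (fun B => 1 - expNegH (Ht) B φ) X₁ * fluct D.𝒞 (polyP2 (L ^ k) H K (X \ X₁)) φ)) -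
          (bprod (L ^ k) (fun B => expNegH (Ht) B φ) (U \ X) * bprod (L ^ k) (fun B => expNegH (-(Ht)) B φ) (X \ U) *
            (bprod (L ^ k) (fun B => 1 - expNegH (Ht) B φ) X₁ * fluct Db.𝒞 (polyP2 (L ^ k) H K (X \ X₁)) φ)))) + (fun φ => (∑ B ∈ blockPartIndex D U,
        bprod (L ^ k) (fun B' => expNegH Ht B' φ) (U \ B) *
            bprod (L ^ k) (fun B' => expNegH (-Ht) B' φ) (B \ U) *
          (expNegH (nextH D H K) B φ - expNegH Ht B φ)) -
        (∑ B ∈ blockPartIndex D U,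
        bprod (L ^ k) (fun B' => expNegH Ht B' φ) (U \ B) *
            bprod (L ^ k) (fun B' => expNegH (-Ht) B' φ) (B \ U) *
          (expNegH (nextH Db H K) B φ - expNegH Ht B φ))) := by
    funext ψ
    simp only [Pi.add_apply]
    rw [hdecF ψ, hdecF' ψ, hbpi]
    simp only [sum_sub_distrib]
    ring
  rw [hfun]
  exact s5

set_option maxHeartbeats 1600000 in
/-- **Raw two-kernel bound at a common free `H̃` on a connected `(k+1)`-polymer** (module docstring): the sum of the six piece
constants (block part, four kernel-only twins at `H̃`, defect twin).  Hypotheses as in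
`tayNormLE_nextKStep_kernel_sub_abkm_raw_of_stepKernelBounds` (two step kernels with `StepKernelBounds`, pair properties `(ℓc, κc)`,
`(ℓn, κ_p)`, `‖H‖ ≤ b ≤ 1/64`, `‖K‖ ≤ C`, translation invariant `K`, `2b + C_{8.7}CA_𝒫A^{−1} ≤ τ ≤ 1/16`) plus a FREE `H̃` with
`‖H̃‖_{k,0} ≤ τ`; letters `8e^{1/4}τ ≤ ω`, `16e^{1/4}b ≤ ω`, `2C ≤ ω`, `ωA² ≤ 1`, `1 + e^{1/4} ≤ κ`, `1 + e^{1/4} + 16e^{3/8}τ ≤ κ₁`.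
[cite: AdamsBuchholzKoteckyMuller2019, Theorem 6.8 (6.59)–(6.60) / Lemma 8.4 / Lemma 12.6 (12.53)] -/
theorem tayNormLE_nextK_freeHt_kernel_sub_abkm_raw_of_stepKernelBounds {L N Mord R n p r₀ : ℕ}
    {θbar lam μ δ₁ δ₀ A𝒫 A𝒫a A𝒫b C₂a C₂b h A : ℝ}
    {𝒞 : ℕ → (Fin d → ZMod M) → ℝ} (hd : 3 ≤ d) (hLodd : Odd L) (hL : 2 ^ (d + 3) + 16 * R ≤ L)
    (hR2 : 2 ≤ R) (hM : M = L ^ N) {k : ℕ} (hkN : k + 1 ≤ N)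
    (hp : d / 2 + 2 ≤ p) (hpM : p + d ≤ Mord) (hMR : Mord ≤ R) (hr₀ : 3 ≤ r₀)
    (hB : AbkmWeightBounds L N Mord R n θbar lam μ δ₁ δ₀ A𝒫 𝒞
      (abkmWeightData L N Mord R θbar (schedDelta δ₀ δ₁ N) 𝒞))
    (hδ₀ : 0 < δ₀) (hδ₁ : 0 < δ₁) (hh : 0 < h) (hh0 : hZeroSq d R δ₀ δ₁ ≤ h ^ 2)
    (hh2a : C₂a ≤ h ^ 2) (hh2b : C₂b ≤ h ^ 2) (hA𝒫a : 0 ≤ A𝒫a) (hA𝒫b : 0 ≤ A𝒫b) (hA1 : 1 ≤ A)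
    {κc : ℝ} (hκc : 0 ≤ κc) (hκcA : κc ≤ A)
    (hsmallc : (2 : ℝ) ^ (L ^ d) * (κc * A ^ (-(1 - (1 + 1 / ((2 * (2 ^ d + 1) + 6 : ℝ) ^ d))⁻¹) : ℝ)) ≤ 1)
    (D Db : StepData d M) (hDs : D.s = L ^ k) (hDL : D.L = L) (hDbs : Db.s = L ^ k) (hDbL : Db.L = L)
    (hS : StepKernelBounds (abkmWeightData L N Mord R θbar (schedDelta δ₀ δ₁ N) 𝒞) L k A𝒫a C₂a D.𝒞)
    (hSb : StepKernelBounds (abkmWeightData L N Mord R θbar (schedDelta δ₀ δ₁ N) 𝒞) L k A𝒫b C₂b Db.𝒞)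
    {x₀ : Fin d → ZMod M} (hB₀ : D.B₀ = blockOf (L ^ k) x₀) (hc₀ : D.c₀ = boxCorner (L ^ k) (starRad R L d k) x₀)
    (hDbB : Db.B₀ = D.B₀) (hDbc : Db.c₀ = D.c₀)
    {δγ : ℝ} (hδγ : 0 ≤ δγ)
    (hγab : ∀ q, ((L ^ (d * k) : ℕ) : ℝ) * |gradCov D.𝒞 q - gradCov Db.𝒞 q| ≤ δγ)
    {ℓc : ℝ} (hℓc : 0 ≤ ℓc)
    (hdint : ∀ X : Finset (Fin d → ZMod M), IsPolymer (L ^ k) X → IsConn X →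
      ∀ (F : ((Fin d → ZMod M) → ℝ) → ℂ) (C : ℝ), 0 ≤ C → ContDiff ℝ r₀ F →
        IsGaugeLocal ((abkmNormParams L N Mord R p r₀ h θbar A (schedDelta δ₀ δ₁ N) 𝒞).gauge k X) F →
        TayNormLE ((abkmNormParams L N Mord R p r₀ h θbar A (schedDelta δ₀ δ₁ N) 𝒞).gauge k X) r₀
          ((abkmWeightData L N Mord R θbar (schedDelta δ₀ δ₁ N) 𝒞).weight k X) F C →
          TayNormLE ((abkmNormParams L N Mord R p r₀ h θbar A (schedDelta δ₀ δ₁ N) 𝒞).gauge k X) r₀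
            ((abkmWeightData L N Mord R θbar (schedDelta δ₀ δ₁ N) 𝒞).midWeight k X)
            (fluct D.𝒞 F - fluct Db.𝒞 F) (C * ℓc * κc ^ numBlocks (L ^ k) X))
    {U : Finset (Fin d → ZMod M)} (hU : IsPolymer (L ^ (k + 1)) U) (hUc : IsConn U)
    {ℓn κp : ℝ} (hℓn : 0 ≤ ℓn) (hκp : 0 ≤ κp)
    (hdiffU : ∀ X : Finset (Fin d → ZMod M), IsPolymer (L ^ k) X → X ⊆ thicken ((2 ^ d - 1) * L ^ k) U →
      ∀ (F : ((Fin d → ZMod M) → ℝ) → ℂ) (b : ℝ), 0 ≤ b → ContDiff ℝ r₀ F →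
        IsGaugeLocal ((abkmNormParams L N Mord R p r₀ h θbar A (schedDelta δ₀ δ₁ N) 𝒞).gauge k X) F →
        TayNormLE ((abkmNormParams L N Mord R p r₀ h θbar A (schedDelta δ₀ δ₁ N) 𝒞).gauge k X) r₀
          ((abkmWeightData L N Mord R θbar (schedDelta δ₀ δ₁ N) 𝒞).weight k X) F b →
          TayNormLE ((abkmNormParams L N Mord R p r₀ h θbar A (schedDelta δ₀ δ₁ N) 𝒞).gauge k X) r₀
            ((abkmWeightData L N Mord R θbar (schedDelta δ₀ δ₁ N) 𝒞).midWeight k X)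
            (fluct D.𝒞 F - fluct Db.𝒞 F) (b * ℓn * κp ^ numBlocks (L ^ k) X))
    {H : RelevantHamiltonian ℂ d} {b : ℝ}
    (hH : hamNorm (fieldWt h (L : ℝ) d k) ((L : ℝ) ^ k) (L ^ (d * k)) H ≤ b) (hb : b ≤ 1 / 64)
    {K : Finset (Fin d → ZMod M) → ((Fin d → ZMod M) → ℝ) → ℂ} {C : ℝ} (hC : 0 ≤ C)
    (hK : WeakNormLE (abkmNormParams L N Mord R p r₀ h θbar A (schedDelta δ₀ δ₁ N) 𝒞) k K C)
    (hKfac : Factorises (L ^ k) K) (hK0 : ∀ φ, K ∅ φ = 1) (hKd : ∀ Y, ContDiff ℝ r₀ (K Y))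
    (hKloc : ∀ Y, IsPolymer (L ^ k) Y → IsConn Y →
      IsGaugeLocal ((abkmNormParams L N Mord R p r₀ h θbar A (schedDelta δ₀ δ₁ N) 𝒞).gauge k Y) (K Y))
    (hKt : TransInv (L ^ k) K)
    (hva : pi2BoundConst d (((2 * R + 2 : ℕ) : ℝ) + ((d / 2 + 1 : ℕ) : ℝ)) * (C * A𝒫a * A⁻¹) ≤ 1 / 64)
    (hvb : pi2BoundConst d (((2 * R + 2 : ℕ) : ℝ) + ((d / 2 + 1 : ℕ) : ℝ)) * (C * A𝒫b * A⁻¹) ≤ 1 / 64)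
    {τ : ℝ} (hτa : 2 * b + pi2BoundConst d (((2 * R + 2 : ℕ) : ℝ) + ((d / 2 + 1 : ℕ) : ℝ)) * (C * A𝒫a * A⁻¹) ≤ τ)
    (hτb : 2 * b + pi2BoundConst d (((2 * R + 2 : ℕ) : ℝ) + ((d / 2 + 1 : ℕ) : ℝ)) * (C * A𝒫b * A⁻¹) ≤ τ)
    (hτ : τ ≤ 1 / 16)
    {Ht : RelevantHamiltonian ℂ d} (hHt : hamNorm (fieldWt h (L : ℝ) d k) ((L : ℝ) ^ k) (L ^ (d * k)) Ht ≤ τ)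
    {ω κ κ₁ : ℝ}
    (hω1 : 8 * Real.exp (1 / 4) * τ ≤ ω)
    (hω2 : 8 * Real.exp (1 / 4) * b + 8 * Real.exp (1 / 4) * b ≤ ω)
    (hω3 : C + C ≤ ω) (hωA : ω * A ^ 2 ≤ 1)
    (hκ : 1 + Real.exp (1 / 4) ≤ κ)
    (hκ₁' : 1 + Real.exp (1 / 4) + 16 * Real.exp (3 / 8) * τ ≤ κ₁) :
    TayNormLE ((abkmNormParams L N Mord R p r₀ h θbar A (schedDelta δ₀ δ₁ N) 𝒞).gauge (k + 1) U) r₀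
      ((abkmWeightData L N Mord R θbar (schedDelta δ₀ δ₁ N) 𝒞).weight (k + 1) U)
      (fun φ => nextK D.s (reblock D.s (D.L * D.s)) (stepMeasure D.𝒞) (expNegH H) (expNegH Ht) K U φ -
        nextK Db.s (reblock Db.s (Db.L * Db.s)) (stepMeasure Db.𝒞) (expNegH H) (expNegH Ht) K U φ)
      (
      (C * ((L : ℝ) ^ d * ((ℓc * κc) * abkmContrConst d L R) +
          ℓc * largePartEps d L A κc (1 + 1 / ((2 * (2 ^ d + 1) + 6 : ℝ) ^ d)) +
          ℓc * largePartEps d L A κc (1 + 1 / ((2 * (2 ^ d + 1) + 6 : ℝ) ^ d))) *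
        (abkmNormParams L N Mord R p r₀ h θbar A (schedDelta δ₀ δ₁ N) 𝒞).aFactor (k + 1) U) +
      ((blocks (L ^ k) U).card * κ₁ ^ (blocks (L ^ k) U).card *
        (16 * Real.exp (3 / 8) * τ *
            ((1 + 8 * pi2BoundConst d (((2 * R + 2 : ℕ) : ℝ) + ((d / 2 + 1 : ℕ) : ℝ))) * (C * ℓc * κc * A⁻¹)) +
          (512 * Real.exp (1 / 4) *
              (b * (pi2BoundConst d (((2 * R + 2 : ℕ) : ℝ) + ((d / 2 + 1 : ℕ) : ℝ)) * (C * ℓc * κc * A⁻¹))) +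
            256 * Real.exp (1 / 4) *
              (pi2BoundConst d (((2 * R + 2 : ℕ) : ℝ) + ((d / 2 + 1 : ℕ) : ℝ)) * (C * A𝒫b * A⁻¹) +
                pi2BoundConst d (((2 * R + 2 : ℕ) : ℝ) + ((d / 2 + 1 : ℕ) : ℝ)) * (C * ℓc * κc * A⁻¹)) *
              (pi2BoundConst d (((2 * R + 2 : ℕ) : ℝ) + ((d / 2 + 1 : ℕ) : ℝ)) * (C * ℓc * κc * A⁻¹)) +
            (8 * Real.exp (1 / 4) * b * ℓc * κc + 16 * Real.exp (3 / 8) * (δγ / h ^ 2 * b) +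
              256 * Real.exp (1 / 4) * (2 * (δγ / h ^ 2 * b)) *
                (pi2BoundConst d (((2 * R + 2 : ℕ) : ℝ) + ((d / 2 + 1 : ℕ) : ℝ)) * (C * A𝒫b * A⁻¹)))))) +
      (ℓn *
      ((κ ^ (blocks (L ^ k) U).card *
          ((8 * Real.exp (1 / 4) * hamNorm (fieldWt h (L : ℝ) d k) ((L : ℝ) ^ k) (L ^ (d * k)) H + C) *
            (ω * A ^ 4)) *
        (((2 * (2 * κ * max 1 (max A𝒫a κp))) ^ ((2 ^ (d + 1) + 2) ^ d * L ^ d) * (4 : ℝ) ^ ((2 ^ (d + 1) + 2) ^ d * L ^ d)) ^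
            (blocks (L * L ^ k) U).card *
          A ^ (-((1 + 1 / ((2 * (2 ^ d + 1) + 6 : ℝ) ^ d)) * (blocks (L * L ^ k) U).card) : ℝ)) +
      κ ^ (blocks (L ^ k) U).card * C *
        (((2 * κ * max 1 (max A𝒫a κp)) ^ ((2 ^ (d + 1) + 2) ^ d * L ^ d) * (2 : ℝ) ^ ((2 ^ (d + 1) + 2) ^ d * L ^ d)) ^
            (blocks (L * L ^ k) U).card *
          A ^ (-((1 + 1 / ((2 * (2 ^ d + 1) + 6 : ℝ) ^ d)) * (blocks (L * L ^ k) U).card) : ℝ))))) +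
      (ℓn *
      (κ ^ (blocks (L ^ k) U).card *
          ((8 * Real.exp (1 / 4) * hamNorm (fieldWt h (L : ℝ) d k) ((L : ℝ) ^ k) (L ^ (d * k)) H + C) *
            (ω * A ^ 4)) *
        (((2 * (2 * κ * max 1 (max A𝒫a κp))) ^ ((2 ^ (d + 1) + 2) ^ d * L ^ d) * (4 : ℝ) ^ ((2 ^ (d + 1) + 2) ^ d * L ^ d)) ^
            (blocks (L * L ^ k) U).card *
          A ^ (-((1 + 1 / ((2 * (2 ^ d + 1) + 6 : ℝ) ^ d)) * (blocks (L * L ^ k) U).card) : ℝ)))) +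
      (ℓn *
      (κ ^ (blocks (L ^ k) U).card *
          ((8 * Real.exp (1 / 4) * hamNorm (fieldWt h (L : ℝ) d k) ((L : ℝ) ^ k) (L ^ (d * k)) H + C) *
            (ω * A ^ 4)) *
        (((2 * (2 * κ * max 1 (max A𝒫a κp))) ^ ((2 ^ (d + 1) + 2) ^ d * L ^ d) * (4 : ℝ) ^ ((2 ^ (d + 1) + 2) ^ d * L ^ d)) ^
            (blocks (L * L ^ k) U).card *
          A ^ (-((1 + 1 / ((2 * (2 ^ d + 1) + 6 : ℝ) ^ d)) * (blocks (L * L ^ k) U).card) : ℝ)))) +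
      ((blocks (L ^ k) U).card * κ₁ ^ (blocks (L ^ k) U).card *
        (16 * Real.exp (3 / 8) *
          hamNorm (fieldWt h (L : ℝ) d k) ((L : ℝ) ^ k) (L ^ (d * k)) (nextH D H K - nextH Db H K)))) := by
  set P := abkmNormParams L N Mord R p r₀ h θbar A (schedDelta δ₀ δ₁ N) 𝒞 with hP
  -- sizes and derived hypotheses
  have hd2 : 2 ≤ d := by omega
  have hp1 : d / 2 + 1 ≤ p := by omega
  have hpR : p ≤ R := by omega
  have hMord : d / 2 + 1 ≤ Mord := by omega
  have hr₀2 : 2 ≤ r₀ := by omega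
  have hL0 : (0 : ℝ) < L := by exact_mod_cast hLodd.pos
  have hA0 : 0 < A := by linarith
  have hDbs' : Db.s = D.s := hDbs.trans hDs.symm
  have hDbL' : Db.L = D.L := hDbL.trans hDL.symm
  have hB₀b : Db.B₀ = blockOf (L ^ k) x₀ := hDbB.trans hB₀
  have hc₀b : Db.c₀ = boxCorner (L ^ k) (starRad R L d k) x₀ := hDbc.trans hc₀
  have hUne : U.Nonempty := hUc.1
  have h𝔥 : 0 < fieldWt h (L : ℝ) d k := fieldWt_pos hh hL0 d k
  have hRk : (0 : ℝ) < (L : ℝ) ^ k := by positivity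
  have hnn : ∀ G : RelevantHamiltonian ℂ d, 0 ≤ hamNorm (fieldWt h (L : ℝ) d k) ((L : ℝ) ^ k) (L ^ (d * k)) G := fun G => hamNorm_nonneg h𝔥.le hRk.le _ _
  have hb0 : 0 ≤ b := (hnn H).trans hH
  have hH64 : hamNorm (fieldWt h (L : ℝ) d k) ((L : ℝ) ^ k) (L ^ (d * k)) H ≤ 1 / 64 := hH.trans hb
  have hH16 : hamNorm (fieldWt h (L : ℝ) d k) ((L : ℝ) ^ k) (L ^ (d * k)) H ≤ 1 / 16 := hH64.trans (by norm_num)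
  have hH8 : hamNorm (fieldWt h (L : ℝ) d k) ((L : ℝ) ^ k) (L ^ (d * k)) H ≤ 1 / 8 := hH64.trans (by norm_num)
  -- the extracted Hamiltonians
  have hHta : hamNorm (fieldWt h (L : ℝ) d k) ((L : ℝ) ^ k) (L ^ (d * k)) (nextH D H K) ≤ τ :=
    (hamNorm_nextH_abkm_le_of_stepKernelBounds hd2 hLodd hL hM hkN hp1 hpR hr₀2 hB hh hh2a hA1 D hS hB₀ hc₀ H hC hK hKd
      hKloc).trans (by linarith [hH])
  have hHtb : hamNorm (fieldWt h (L : ℝ) d k) ((L : ℝ) ^ k) (L ^ (d * k)) (nextH Db H K) ≤ τ :=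
    (hamNorm_nextH_abkm_le_of_stepKernelBounds hd2 hLodd hL hM hkN hp1 hpR hr₀2 hB hh hh2b hA1 Db hSb hB₀b hc₀b H hC hK hKd
      hKloc).trans (by linarith [hH])
  -- letters
  have hbbω : 8 * Real.exp (1 / 4) * hamNorm (fieldWt h (L : ℝ) d k) ((L : ℝ) ^ k) (L ^ (d * k)) H + 8 * Real.exp (1 / 4) * hamNorm (fieldWt h (L : ℝ) d k) ((L : ℝ) ^ k) (L ^ (d * k)) H ≤ ω := by
    have : 8 * Real.exp (1 / 4) * hamNorm (fieldWt h (L : ℝ) d k) ((L : ℝ) ^ k) (L ^ (d * k)) H ≤ 8 * Real.exp (1 / 4) * b := mul_le_mul_of_nonneg_left hH (by positivity)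
    linarith
  have hκ₁'' : 1 + Real.exp (1 / 4) ≤ κ₁ := by
    have : 0 ≤ 16 * Real.exp (3 / 8) * τ := by
      have := (hnn Ht).trans hHt
      positivity
    linarith
  -- the six pieces
  have h0 := tayNormLE_blockPart_kernelOnly_sub_abkm_of_stepKernelBounds (n := n) (lam := lam) (μ := μ) hd hLodd hL hM hkN hp hpM
    hMR hr₀ hB hδ₀ hδ₁ hh hh0 hA1 hκc hκcA hsmallc D Db hDs hDL hS hSb hDbs' hDbL' hDbB hDbc hB₀ hc₀ hℓc hdint hC hK hKt hKd
    hKloc hU hUc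
  have h1 := tayNormLE_remainderOne_kernelOnly_sub_abkm_of_stepKernelBounds (p := p) (r₀ := r₀) (A := A) hd hLodd hL hR2 hM hkN
    hp1 hpM hMR hr₀ hB hδ₀ hδ₁ hh hh0 hh2a hh2b hA𝒫a hA𝒫b hA1 D Db hDs hDL hS hSb hB₀ hc₀ hDbB hDbc hδγ hγab hℓc hκc hdint
    hU hHt hτ hH hb hC hK hKd hKloc hva hvb hκ₁'
  have h2 := tayNormLE_remainderTwoLarge_kernelOnly_sub_abkm (n := n) (lam := lam) (μ := μ) hd hLodd hL hR2 hM hkN hS hSb hp1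
    hMord hB hδ₀ hδ₁ hh hh0 hA𝒫a hA1 hU hHt hτ hH16 hC hK hKfac hK0 hKd hKloc hℓn hκp hdiffU hω1 hbbω hω3 hωA hκ
  have h3 := tayNormLE_remainderThree_kernelOnly_sub_abkm (n := n) (lam := lam) (μ := μ) hd hLodd hL hR2 hM hkN hS hSb hp1
    hMord hB hδ₀ hδ₁ hh hh0 hA𝒫a hA1 hU hUne hHt hτ hH16 hC hK hKfac hK0 hKd hKloc hℓn hκp hdiffU hω1 hbbω hω3 hωA hκ
  have h4 := tayNormLE_remainderFour_kernelOnly_sub_abkm (n := n) (lam := lam) (μ := μ) hd hLodd hL hR2 hM hkN hS hSb hp1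
    hMord hB hδ₀ hδ₁ hh hh0 hA𝒫a hA1 hU hHt hτ hH16 hC hK hKfac hK0 hKd hKloc hℓn hκp hdiffU hω1 hbbω hω3 hωA hκ
  have h5' := tayNormLE_blockDefect_sub_abkm (n := n) (lam := lam) (μ := μ) (A𝒫 := A𝒫) (p := p) (r₀ := r₀) (A := A) hd hLodd hL hR2 hM
    hkN hp1 hMord hB hδ₀ hδ₁ hh hh0 D hDs hDL hU (Ht := Ht) (H₁ := nextH D H K) (H₂ := nextH Db H K) hHt hτ (hHta.trans hτ)
    (hHtb.trans hτ) hκ₁''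
  have h5 : TayNormLE (P.gauge (k + 1) U) r₀ ((abkmWeightData L N Mord R θbar (schedDelta δ₀ δ₁ N) 𝒞).weight (k + 1) U)
      (fun φ => (∑ B ∈ blockPartIndex D U,
        bprod (L ^ k) (fun B' => expNegH Ht B' φ) (U \ B) *
            bprod (L ^ k) (fun B' => expNegH (-Ht) B' φ) (B \ U) *
          (expNegH (nextH D H K) B φ - expNegH Ht B φ)) -
        (∑ B ∈ blockPartIndex D U,
        bprod (L ^ k) (fun B' => expNegH Ht B' φ) (U \ B) *
            bprod (L ^ k) (fun B' => expNegH (-Ht) B' φ) (B \ U) *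
          (expNegH (nextH Db H K) B φ - expNegH Ht B φ))) ((blocks (L ^ k) U).card * κ₁ ^ (blocks (L ^ k) U).card *
        (16 * Real.exp (3 / 8) *
          hamNorm (fieldWt h (L : ℝ) d k) ((L : ℝ) ^ k) (L ^ (d * k)) (nextH D H K - nextH Db H K))) := by
    have e : (fun φ => (∑ B ∈ blockPartIndex D U,
        bprod (L ^ k) (fun B' => expNegH Ht B' φ) (U \ B) *
            bprod (L ^ k) (fun B' => expNegH (-Ht) B' φ) (B \ U) *
          (expNegH (nextH D H K) B φ - expNegH Ht B φ)) -
        (∑ B ∈ blockPartIndex D U,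
        bprod (L ^ k) (fun B' => expNegH Ht B' φ) (U \ B) *
            bprod (L ^ k) (fun B' => expNegH (-Ht) B' φ) (B \ U) *
          (expNegH (nextH Db H K) B φ - expNegH Ht B φ))) = (fun φ => ∑ B ∈ blockPartIndex D U,
        bprod (L ^ k) (fun B' => expNegH Ht B' φ) (U \ B) *
            bprod (L ^ k) (fun B' => expNegH (-Ht) B' φ) (B \ U) *
          (expNegH (nextH D H K) B φ - expNegH (nextH Db H K) B φ)) := by
      funext φ
      rw [← sum_sub_distrib]
      exact sum_congr rfl fun B _ => by ring
    rw [e]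
    exact h5'
  exact tayNormLE_nextK_freeHt_kernel_sub_of_pieces (n := n) (lam := lam) (μ := μ) hd2 hLodd hL hM hkN hp1 hpR hMord hB hδ₀ hδ₁ hh
    hh0 hA0 D Db hDs hDL hDbs hDbL hS hSb hB₀ hc₀ hB₀b hc₀b hH8 Ht hC hK hKfac hK0 hKd hKloc hUne h0 h1 h2 h3 h4 h5

end Literature.MathematicalPhysics.StatisticalMechanics.GradientRG

end
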